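import Summits.RiemannHypothesis.RiemannHypothesis.Theorems.PfPersistenceGalerkinFormTests
import Summits.RiemannHypothesis.RiemannHypothesis.Theorems.PfPersistenceGalerkinFormRadiusArch
import HarnessLib

/-!
# PF persistence — GAL-0 piece (ii) PROVED: `CutoffProfileFormDensity` (pub-rhpf barrier-prover g2)

HONEST FRAMING: long-odds mechanism search; no RH claims.  This is the RH-free ANALYTIC input
(ii) of the Galerkin comparison GAL-0 typed in `…GalerkinFormDomain`
(`galerkinRayleighRitz_of_identity_of_density : GalerkinMatrixIdentity → CutoffProfileFormDensity →
GalerkinRayleighRitz`); piece (i), the window-matrix identity, is cand-3's.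

**Theorem `cutoffProfileFormDensity`.**  For every window `(a, N)`, coefficient vector `v` and
`δ > 0` there is an EVEN Weil test function `g` supported in `[-a, a]` with
`|‖g‖₂² - ‖G‖₂²| ≤ δ` and `|Re Q(g) - Re Q(G)| ≤ δ`, where `G = 1_{[-a,a]} θ_v` is the cut-off
Galerkin profile and `Q` is Weil's quadratic form extended by the same formula.

Proof (assembled from the STEP files Mellin / Decay / Autocorr / Engine / Tests / Radius /
RadiusArch): TRUNCATE, THEN MOLLIFY.  With `θ = θ_v ∈ C^∞`, `F_b = 1_{[-b,b]} θ`, `A_b = F_b ⋆ F̃_b`: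
(1) radius — along `b_n = a - a/(n+2) ↑ a`, `W(A_{b_n}) → W(A_a) = Q(G)` and `‖F_{b_n}‖² → ‖G‖²`
(`tendsto_form_and_mass_cutoffAt`: finite prime sum, polar term, and dominated convergence of
the archimedean integral under the uniform IBP decay); fix `b = b_n < a` with both errors `< δ/2`;
(2) mollify — `g_k = F_b ⋆ φ_k` is a test function, even, supported in `[-(b + r_k), b + r_k]`,
and by the autocorrelation identity `g_k ⋆ g̃_k = A_b ⋆ ν_k` (`ν_k = φ_k ⋆ φ_k`) the engine gives
`Q(g_k) = W(A_b ⋆ ν_k) → W(A_b)` and `‖g_k‖² = (A_b ⋆ ν_k)(0) → A_b(0) = ‖F_b‖²`; take `k` with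
both errors `< δ/2` and `r_k < a - b`.
-/

set_option linter.dupNamespace false

noncomputable section

open Complex Filter Set MeasureTheory Topology
open scoped Real ComplexConjugate

namespace Summit.RiemannHypothesis.RiemannHypothesis.Theorems.PfPersistence

open Literature.NumberTheory.LFunctions Literature.NumberTheory.LFunctions.WeilContinuous

/-! ## §1 The radius sequence `b_n = a - a/(n+2)` -/

/-- `b_n = a - a/(n+2)`. -/
def radiusSeq (a : ℝ) (n : ℕ) : ℝ := a - a / (n + 2)

/-- `b_n ∈ [0, a]` for `a ≥ 0`. [folklore] -/
theorem radiusSeq_mem {a : ℝ} (ha : 0 ≤ a) (n : ℕ) : radiusSeq a n ∈ Icc 0 a := by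
  unfold radiusSeq
  have h1 : a / (n + 2) ≤ a := div_le_self ha (by norm_cast; omega)
  have h2 : 0 ≤ a / (n + 2) := by positivity
  exact ⟨by linarith, by linarith⟩

/-- `b_n < a` for `a > 0`. [folklore] -/
theorem radiusSeq_lt {a : ℝ} (ha : 0 < a) (n : ℕ) : radiusSeq a n < a := by
  unfold radiusSeq
  have : 0 < a / (n + 2) := by positivity
  linarith

/-- `0 < b_n` for `a > 0`. [folklore] -/
theorem radiusSeq_pos {a : ℝ} (ha : 0 < a) (n : ℕ) : 0 < radiusSeq a n := by
  unfold radiusSeq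
  have : a / (n + 2) ≤ a / 2 :=
    div_le_div_of_nonneg_left ha.le (by norm_num) (by norm_cast; omega)
  linarith

/-- `b_n → a`. [folklore] -/
theorem tendsto_radiusSeq (a : ℝ) : Tendsto (radiusSeq a) atTop (𝓝 a) := by
  have h1 : Tendsto (fun n : ℕ ↦ 1 / ((n : ℝ) + 2)) atTop (𝓝 0) := by
    have h0 : Tendsto (fun n : ℕ ↦ 1 / ((n : ℝ) + 1)) atTop (𝓝 0) :=
      tendsto_one_div_add_atTop_nhds_zero_nat
    have := h0.comp (tendsto_add_atTop_nat 1)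
    refine this.congr fun n ↦ ?_
    simp only [Function.comp_apply, Nat.cast_add, Nat.cast_one]
    ring_nf
  have h2 : Tendsto (fun n : ℕ ↦ a - a * (1 / ((n : ℝ) + 2))) atTop (𝓝 (a - a * 0)) :=
    (h1.const_mul a).const_sub a
  rw [mul_zero, sub_zero] at h2
  refine h2.congr fun n ↦ ?_
  unfold radiusSeq
  ring

/-! ## §2 The theorem -/

/-- **GAL-0 piece (ii)**: the cut-off Galerkin profiles are approximated, in `L²`-mass and in the
(real part of the) Weil form simultaneously, by even test functions inside the window.
RH-free. [folklore] -/
theorem cutoffProfileFormDensity : CutoffProfileFormDensity := by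
  intro win v δ hδ
  have ha : 0 < win.a := win.ha
  set θ : ℝ → ℂ := profileC (2 * win.a) v with hθ
  have hθd : ∀ x, HasDerivAt θ (((deriv (fun y ↦ profile (2 * win.a) v y) x : ℝ) : ℂ)) x :=
    hasDerivAt_profileC _ v
  have hθ' : Continuous fun x ↦ ((deriv (fun y ↦ profile (2 * win.a) v y) x : ℝ) : ℂ) :=
    continuous_deriv_profileC _ v
  have hθc : Continuous θ := continuous_profileC _ v
  have hG : cutoffProfile win v = cutoffAt win.a θ := cutoffProfile_eq_indicator win v
  -- STEP 1: the radius
  obtain ⟨hW, hM⟩ := tendsto_form_and_mass_cutoffAt hθd hθ' (b := radiusSeq win.a) (B := win.a)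
    (fun n ↦ radiusSeq_mem ha.le n) ⟨ha.le, le_rfl⟩ (tendsto_radiusSeq win.a)
  have h1 : ∀ᶠ n in atTop, dist (weilFunctional (autocorrAt (radiusSeq win.a n) θ))
      (weilFunctional (autocorrAt win.a θ)) < δ / 2 := Metric.tendsto_nhds.1 hW _ (by positivity)
  have h2 : ∀ᶠ n in atTop, dist (∫ t, ‖cutoffAt (radiusSeq win.a n) θ t‖ ^ 2)
      (∫ t, ‖cutoffAt win.a θ t‖ ^ 2) < δ / 2 := Metric.tendsto_nhds.1 hM _ (by positivity)
  obtain ⟨n, hn1, hn2⟩ := (h1.and h2).exists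
  have hb0 : 0 < radiusSeq win.a n := radiusSeq_pos ha n
  have hba : radiusSeq win.a n < win.a := radiusSeq_lt ha n
  set b : ℝ := radiusSeq win.a n with hb_def
  -- STEP 2: the rough function `F = F_b` and its autocorrelation `A_b`
  set F : ℝ → ℂ := cutoffAt b θ with hF
  have hFm : Measurable F := hθc.measurable.indicator measurableSet_Icc
  have hFi : Integrable F := integrable_cutoffAt hθc b
  have hFs : HasCompactSupport F :=
    HasCompactSupport.intro isCompact_Icc fun x hx ↦ indicator_of_notMem hx θ
  obtain ⟨M, hMb⟩ := isCompact_Icc.exists_bound_of_continuousOn (s := Icc (-b) b) hθc.continuousOn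
  have hFC : ∀ x, ‖F x‖ ≤ max M 0 := by
    intro x
    by_cases hx : x ∈ Icc (-b) b
    · simp only [hF, cutoffAt, indicator_of_mem hx]
      exact (hMb x hx).trans (le_max_left _ _)
    · simp only [hF, cutoffAt, indicator_of_notMem hx, norm_zero]
      exact le_max_right _ _
  have hFR : ∀ u : ℝ, b < |u| → F u = 0 := fun u hu ↦
    indicator_of_notMem (fun h ↦ by have := abs_le.2 ⟨h.1, h.2⟩; linarith) θ
  have hFev : ∀ x, F (-x) = F x := by
    intro x
    simp only [hF, cutoffAt]
    by_cases hx : x ∈ Icc (-b) b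
    · have hnx : -x ∈ Icc (-b) b := ⟨by linarith [hx.2], by linarith [hx.1]⟩
      rw [indicator_of_mem hx, indicator_of_mem hnx]
      simp only [hθ, profileC, CollarBound.profile_neg_arg]
    · have hnx : -x ∉ Icc (-b) b := fun h ↦ hx ⟨by linarith [h.2], by linarith [h.1]⟩
      rw [indicator_of_notMem hx, indicator_of_notMem hnx]
  have hAc : Continuous (autocorrAt b θ) := continuous_weilConv_weilReflect_cutoff hθc b
  have hAs : HasCompactSupport (autocorrAt b θ) := hasCompactSupport_weilConv_weilReflect_cutoff θ b
  have hAA := integrable_weilArchIntegrand_autocorrAt hθd hθ' hb0.le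
  -- the two limits in `k`, and the support radius
  have h3 : ∀ᶠ k : ℕ in atTop, dist (weilFunctional (weilConv (autocorrAt b θ) (mollSq k)))
      (weilFunctional (autocorrAt b θ)) < δ / 2 :=
    Metric.tendsto_nhds.1 (tendsto_weilFunctional_mollSq hAc hAs hAA) _ (by positivity)
  have h4 : ∀ᶠ k : ℕ in atTop, dist (weilConv (autocorrAt b θ) (mollSq k) 0) (autocorrAt b θ 0) <
      δ / 2 := Metric.tendsto_nhds.1 (tendsto_weilConv_mollSq hAc 0) _ (by positivity)
  have h5 : ∀ᶠ k : ℕ in atTop, (bump k).rOut < win.a - b := by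
    refine (Metric.tendsto_nhds.1 tendsto_bump_rOut (win.a - b) (by linarith)).mono fun k hk ↦ ?_
    rw [Real.dist_eq, sub_zero] at hk
    exact (abs_lt.1 hk).2
  obtain ⟨k, ⟨hk3, hk4⟩, hk5⟩ := ((h3.and h4).and h5).exists
  -- the test function `g = F_b ⋆ φ_k`
  refine ⟨weilConv F (moll k), isWeilTest_weilConv_moll_of_locallyIntegrable hFi.locallyIntegrable hFs k,
    (tsupport_weilConv_moll_subset hFR k).trans (Icc_subset_Icc (by linarith) (by linarith)),
    fun t ↦ weilConv_moll_neg hFev k t, ?_, ?_⟩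
  · -- mass
    have e1 : ((∫ t, ‖weilConv F (moll k) t‖ ^ 2 : ℝ) : ℂ) = weilConv (autocorrAt b θ) (mollSq k) 0 :=
      integral_norm_sq_weilConv_moll hFm hFi hFs hFC k
    have e2 : ((∫ t, ‖F t‖ ^ 2 : ℝ) : ℂ) = autocorrAt b θ 0 := (weilConv_weilReflect_apply_zero F).symm
    have d1 : |(∫ t, ‖weilConv F (moll k) t‖ ^ 2) - ∫ t, ‖F t‖ ^ 2| < δ / 2 := by
      have h := hk4
      rw [dist_eq_norm, ← e1, ← e2, ← Complex.ofReal_sub, Complex.norm_real, Real.norm_eq_abs] at h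
      exact h
    have d2 : |(∫ t, ‖F t‖ ^ 2) - ∫ t, ‖cutoffProfile win v t‖ ^ 2| < δ / 2 := by
      rw [hG]
      have h := hn2
      rwa [Real.dist_eq] at h
    calc |(∫ t, ‖weilConv F (moll k) t‖ ^ 2) - ∫ t, ‖cutoffProfile win v t‖ ^ 2|
        = |((∫ t, ‖weilConv F (moll k) t‖ ^ 2) - ∫ t, ‖F t‖ ^ 2) +
            ((∫ t, ‖F t‖ ^ 2) - ∫ t, ‖cutoffProfile win v t‖ ^ 2)| := by ring_nf
      _ ≤ |(∫ t, ‖weilConv F (moll k) t‖ ^ 2) - ∫ t, ‖F t‖ ^ 2| +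
            |(∫ t, ‖F t‖ ^ 2) - ∫ t, ‖cutoffProfile win v t‖ ^ 2| := abs_add_le _ _
      _ ≤ δ := by linarith
  · -- form
    have e3 : weilQuadratic (weilConv F (moll k)) =
        weilFunctional (weilConv (autocorrAt b θ) (mollSq k)) :=
      weilQuadratic_weilConv_moll hFm hFi hFs hFC k
    have e4 : weilQuadratic (cutoffProfile win v) = weilFunctional (autocorrAt win.a θ) := by
      rw [hG]; rfl
    have d3 : ‖weilQuadratic (weilConv F (moll k)) - weilFunctional (autocorrAt b θ)‖ < δ / 2 := by
      rw [e3, ← dist_eq_norm]; exact hk3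
    have d4 : ‖weilFunctional (autocorrAt b θ) - weilQuadratic (cutoffProfile win v)‖ < δ / 2 := by
      rw [e4, ← dist_eq_norm]; exact hn1
    calc |(weilQuadratic (weilConv F (moll k))).re - (weilQuadratic (cutoffProfile win v)).re|
        = |(weilQuadratic (weilConv F (moll k)) - weilQuadratic (cutoffProfile win v)).re| := by
          rw [Complex.sub_re]
      _ ≤ ‖weilQuadratic (weilConv F (moll k)) - weilQuadratic (cutoffProfile win v)‖ :=
          Complex.abs_re_le_norm _
      _ = ‖(weilQuadratic (weilConv F (moll k)) - weilFunctional (autocorrAt b θ)) +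
            (weilFunctional (autocorrAt b θ) - weilQuadratic (cutoffProfile win v))‖ := by
          congr 1; ring
      _ ≤ ‖weilQuadratic (weilConv F (moll k)) - weilFunctional (autocorrAt b θ)‖ +
            ‖weilFunctional (autocorrAt b θ) - weilQuadratic (cutoffProfile win v)‖ := norm_add_le _ _
      _ ≤ δ := by linarith

/-- Hence GAL-0 (Rayleigh–Ritz direction) follows from cand-3's window-matrix identity ALONE:
`GalerkinMatrixIdentity → GalerkinRayleighRitz`. [folklore] -/
theorem galerkinRayleighRitz_of_galerkinMatrixIdentity (hI : GalerkinMatrixIdentity) :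
    GalerkinRayleighRitz :=
  galerkinRayleighRitz_of_identity_of_density hI cutoffProfileFormDensity

end Summit.RiemannHypothesis.RiemannHypothesis.Theorems.PfPersistence
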